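import Summits.FinalStateConjecture.FinalStateConjecture.Theorems.PhaseMixingCaptureCaptureSufficesTameNoC0KerrSide
import Literature.Geometry.Lorentzian.KerrSliceFacts
import Literature.Geometry.Lorentzian.OpensCausality
import Literature.Geometry.Lorentzian.CausalCurveNullGeodesic
import Literature.Geometry.Lorentzian.LocalCausalRelationClosed
import Literature.Geometry.Lorentzian.LocalTimeSeparation
import Literature.Geometry.Lorentzian.LorentzianDistance
import Literature.Geometry.Lorentzian.KerrFramedCompactness
import Literature.Geometry.Lorentzian.NormalisedNullRayCausal
import HarnessLib

/-!
# NoC0KerrChart, Kerr side: coordinate causal curves, kinematics and local causality of the Kerr exterior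

Line `only-the-third-law-is-generic` of crux `CaptureSufficesTame` (stmt-FinalStateConjecture-17270), stub G at
the model point (the C⁰-rigidity statement NoC0KerrChart), lead c10. Kerr-side infrastructure of the limit
argument:

* glue between explicit Kerr–Schild coordinate curves (`HasDerivAt` in `E4`) and the tree's causal curves of the
  bundled spacetime `Kerr.exteriorSpacetime M a hM` (`isFutureCausalCurveOn_liftCurve`,
  `hasDerivAt_of_isFutureCausalCurveOn`);
* kinematics: `t*` is a time function with coordinate speed bound `2` along causal curves (the Kerr–Schild
  cone lies inside the coordinate Minkowski cone since `H ≥ 0`; `kinematics_of_isFutureCausalCurveOn`), whence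
  the CAUSALLY CONVEX coordinate neighbourhoods `U_ρ(c) = {‖y − c‖ + 2|y⁰ − c⁰| < ρ}`
  (`causallyConvex_coordNhd`);
* chronologically related points have positive time separation (`lorentzDist_pos_of_mem_chronologicalFuture`,
  via measurability of the coordinate velocity);
* the LOCAL RADIAL REPRESENTATION (`exists_radial_representation`, registered sub-goal `stub_noC0_kerrLocal`):
  near every point, causally related points `p ≤ q` of a causally convex coordinate neighbourhood are joined by
  the radial geodesic `q = exp_p v`, `v` future causal, and `v` is timelike iff `p ≪ q` — from the tree's local
  formula for the time separation (`exists_nhds_lorentzDist_eq_radial`).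
-/

set_option linter.dupNamespace false
set_option maxSynthPendingDepth 3

noncomputable section

open Set Filter Function Bundle MeasureTheory
open scoped Manifold ContDiff Topology ENNReal

namespace Summit.FinalStateConjecture.FinalStateConjecture.Theorems.PhaseMixingCaptureCaptureSufficesTame

open Literature.Geometry.Lorentzian Literature.Geometry.Riemannian

namespace NoC0

/- `Kerr.Facts` is discharged in the tree (`SwallowTheDatum.kerrFacts`); here it is an instance binder. -/

/-- The time component of a vector of `E4` read as a tangent vector. -/
theorem tangent_apply_zero (x : E4) (v : E4) : (show E4 from (v : TangentSpace 𝓘(ℝ, E4) x)) 0 = v 0 := rfl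

variable {M a : ℝ}

/-- Velocity of a lifted coordinate curve. [folklore] -/
theorem velocity_liftCurve (c : ℝ → E4) (h : ∀ t, c t ∈ Kerr.exterior M a) (t : ℝ) :
    (velocity 𝓘(ℝ, E4) (fun t ↦ (⟨c t, h t⟩ : Kerr.exterior M a)) t : E4) = deriv c t := by
  rw [← velocity_subtypeVal_comp (I := 𝓘(ℝ, E4)) (Kerr.exterior M a) (fun t ↦ (⟨c t, h t⟩ : Kerr.exterior M a)) t]
  change mfderiv 𝓘(ℝ, ℝ) 𝓘(ℝ, E4) c t (1 : ℝ) = deriv c t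
  rw [mfderiv_eq_fderiv]
  rfl

/-- Differentiability of a lifted coordinate curve. [folklore] -/
theorem mdifferentiableAt_liftCurve {c : ℝ → E4} (h : ∀ t, c t ∈ Kerr.exterior M a) {t : ℝ}
    (hc : DifferentiableAt ℝ c t) : MDifferentiableAt 𝓘(ℝ, ℝ) 𝓘(ℝ, E4) (fun t ↦ (⟨c t, h t⟩ : Kerr.exterior M a)) t := by
  rw [← mdifferentiableAt_subtypeVal_comp_curve_iff (I := 𝓘(ℝ, E4)) (Kerr.exterior M a)]
  exact hc.mdifferentiableAt

/-- **Coordinate criterion for future causal curves of the Kerr exterior**: if at every `t ∈ s` the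
coordinate curve `c` has derivative `v` with `g_{M,a}(c t)(v, v) ≤ 0` and `v⁰ > 0`, then its lift is a
future causal curve of `Kerr.exteriorSpacetime M a hM` (`g(V, v) = −v⁰ < 0` for the orienting field
`V = −g♯(dt*)`, `Kerr.bilin_timeVector`). [cite: arXiv08110354, §5.1] -/
theorem isFutureCausalCurveOn_liftCurve [Kerr.Facts] (hM : 0 ≤ M) {c : ℝ → E4}
    (h : ∀ t, c t ∈ Kerr.exterior M a) {s : Set ℝ} {v : ℝ → E4}
    (hd : ∀ t ∈ s, HasDerivAt c (v t) t) (hcausal : ∀ t ∈ s, Kerr.bilin M a (c t) (v t) (v t) ≤ 0)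
    (hfut : ∀ t ∈ s, 0 < v t 0) :
    (Kerr.smoothMetric M a (Kerr.rPlus M a)).IsFutureCausalCurveOn
      (Kerr.exteriorSpacetime M a hM).timeOrientation (fun t ↦ (⟨c t, h t⟩ : Kerr.exterior M a)) s := by
  intro t ht
  have hvel : (velocity 𝓘(ℝ, E4) (fun t ↦ (⟨c t, h t⟩ : Kerr.exterior M a)) t : E4) = v t := by
    rw [velocity_liftCurve, (hd t ht).deriv]
  have hr : 0 < Kerr.radius a (c t) := Kerr.radius_pos_of_mem_region (h t)
  refine ⟨mdifferentiableAt_liftCurve h (hd t ht).differentiableAt, ?_, ?_⟩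
  · refine ⟨?_, ?_⟩
    · show Kerr.bilin M a (c t) (velocity 𝓘(ℝ, E4) (fun t ↦ (⟨c t, h t⟩ : Kerr.exterior M a)) t) (velocity 𝓘(ℝ, E4) (fun t ↦ (⟨c t, h t⟩ : Kerr.exterior M a)) t) ≤ 0
      rw [hvel]; exact hcausal t ht
    · intro h0
      have h1 : (v t) 0 = 0 := by
        have := congrArg (fun w : E4 ↦ w 0) (hvel.symm.trans (congrArg (fun w ↦ (w : E4)) h0))
        exact this
      linarith [hfut t ht, h1]
  · show Kerr.bilin M a (c t) (Kerr.timeVector M a (c t)) (velocity 𝓘(ℝ, E4) (fun t ↦ (⟨c t, h t⟩ : Kerr.exterior M a)) t) < 0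
    rw [hvel, Kerr.bilin_timeVector hr]
    linarith [hfut t ht]

/-- Timelike version of `isFutureCausalCurveOn_liftCurve`. [cite: arXiv08110354, §5.1] -/
theorem isFutureTimelikeCurveOn_liftCurve [Kerr.Facts] (hM : 0 ≤ M) {c : ℝ → E4}
    (h : ∀ t, c t ∈ Kerr.exterior M a) {s : Set ℝ} {v : ℝ → E4}
    (hd : ∀ t ∈ s, HasDerivAt c (v t) t) (htl : ∀ t ∈ s, Kerr.bilin M a (c t) (v t) (v t) < 0)
    (hfut : ∀ t ∈ s, 0 < v t 0) :
    (Kerr.smoothMetric M a (Kerr.rPlus M a)).IsFutureTimelikeCurveOn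
      (Kerr.exteriorSpacetime M a hM).timeOrientation (fun t ↦ (⟨c t, h t⟩ : Kerr.exterior M a)) s := by
  intro t ht
  obtain ⟨hmd, hc, hf⟩ := isFutureCausalCurveOn_liftCurve hM h hd (fun t ht ↦ (htl t ht).le) hfut t ht
  have hvel : (velocity 𝓘(ℝ, E4) (fun t ↦ (⟨c t, h t⟩ : Kerr.exterior M a)) t : E4) = v t := by
    rw [velocity_liftCurve, (hd t ht).deriv]
  refine ⟨hmd, ?_, hc, hf⟩
  show Kerr.bilin M a (c t) (velocity 𝓘(ℝ, E4) (fun t ↦ (⟨c t, h t⟩ : Kerr.exterior M a)) t) (velocity 𝓘(ℝ, E4) (fun t ↦ (⟨c t, h t⟩ : Kerr.exterior M a)) t) < 0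
  rw [hvel]; exact htl t ht

/-- **Conversely**: a future causal curve of the Kerr exterior spacetime, read in coordinates, has a
derivative `v` with `g(v, v) ≤ 0`, `v ≠ 0`, `v⁰ > 0` at every parameter of its domain.
[cite: arXiv08110354, §5.1] -/
theorem hasDerivAt_of_isFutureCausalCurveOn [Kerr.Facts] (hM : 0 ≤ M) {γ : ℝ → Kerr.exterior M a}
    {s : Set ℝ}
    (hγ : (Kerr.smoothMetric M a (Kerr.rPlus M a)).IsFutureCausalCurveOn
      (Kerr.exteriorSpacetime M a hM).timeOrientation γ s) {t : ℝ} (ht : t ∈ s) :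
    HasDerivAt (fun t ↦ (γ t : E4)) (velocity 𝓘(ℝ, E4) γ t : E4) t ∧
      Kerr.bilin M a (γ t) (velocity 𝓘(ℝ, E4) γ t) (velocity 𝓘(ℝ, E4) γ t) ≤ 0 ∧
      0 < (show E4 from velocity 𝓘(ℝ, E4) γ t) 0 := by
  obtain ⟨hmd, ⟨hc, hne⟩, hf⟩ := hγ t ht
  have hmd' : MDifferentiableAt 𝓘(ℝ, ℝ) 𝓘(ℝ, E4) (Subtype.val ∘ γ) t :=
    (mdifferentiableAt_subtypeVal_comp_curve_iff (I := 𝓘(ℝ, E4)) (Kerr.exterior M a)).2 hmd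
  have hdiff : DifferentiableAt ℝ (fun t ↦ (γ t : E4)) t := mdifferentiableAt_iff_differentiableAt.mp hmd'
  have hvel : (velocity 𝓘(ℝ, E4) γ t : E4) = deriv (fun t ↦ (γ t : E4)) t := by
    rw [← velocity_subtypeVal_comp (I := 𝓘(ℝ, E4)) (Kerr.exterior M a) γ t]
    change mfderiv 𝓘(ℝ, ℝ) 𝓘(ℝ, E4) (Subtype.val ∘ γ) t (1 : ℝ) = _
    rw [mfderiv_eq_fderiv]
    rfl
  have hr : 0 < Kerr.radius a (γ t : E4) := Kerr.radius_pos_of_mem_region (γ t).2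
  refine ⟨by rw [hvel]; exact hdiff.hasDerivAt, hc, ?_⟩
  have hf' : Kerr.bilin M a (γ t) (Kerr.timeVector M a (γ t)) (velocity 𝓘(ℝ, E4) γ t) < 0 := hf
  rw [Kerr.bilin_timeVector hr] at hf'
  change -((show E4 from velocity 𝓘(ℝ, E4) γ t) 0) < 0 at hf'
  linarith


variable {M a : ℝ}

/-! ## Kinematics: the Kerr–Schild cone lies inside the coordinate Minkowski cone -/

/-- For `0 ≤ M`, a `g_{M,a}`-causal vector has `|v⃗|² ≤ (v⁰)²` (`g = η + 2H ℓ ⊗ ℓ`, `H ≥ 0`), hence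
`‖v‖ ≤ 2 v⁰` when `v⁰ > 0`. [cite: arXiv07060622, (32)–(35)] -/
theorem norm_le_two_mul_of_bilin_nonpos (hM : 0 ≤ M) (x v : E4) (hv : Kerr.bilin M a x v v ≤ 0)
    (hv0 : 0 < v 0) : ‖v‖ ≤ 2 * v 0 := by
  have h := kerr_norm_le_two_mul_abs_time M a x v (Kerr.bilin M a x) hM
    (by rw [sub_self, norm_zero]; norm_num) hv
  rwa [abs_of_pos hv0] at h

/-- **`t*` is a time function with speed bound `2` along causal curves of the Kerr exterior**: for a
future causal curve `γ` on `[s₁, s₂]`, `t ↦ (γ t)⁰` is strictly increasing and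
`‖γ s₂ − γ s₁‖ ≤ 2 ((γ s₂)⁰ − (γ s₁)⁰)`. [cite: arXiv08110354, §5.1] -/
theorem kinematics_of_isFutureCausalCurveOn [Kerr.Facts] (hM : 0 ≤ M) {γ : ℝ → Kerr.exterior M a}
    {s₁ s₂ : ℝ} (hs : s₁ ≤ s₂)
    (hγ : (Kerr.smoothMetric M a (Kerr.rPlus M a)).IsFutureCausalCurveOn
      (Kerr.exteriorSpacetime M a hM).timeOrientation γ (Icc s₁ s₂)) :
    StrictMonoOn (fun t ↦ (γ t : E4) 0) (Icc s₁ s₂) ∧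
      ‖(γ s₂ : E4) - γ s₁‖ ≤ 2 * ((γ s₂ : E4) 0 - (γ s₁ : E4) 0) := by
  refine kerr_time_strictMonoOn_and_norm_sub_le M a (fun t ↦ Kerr.bilin M a (γ t : E4))
    (fun t ↦ (γ t : E4)) s₁ s₂ hM hs fun t ht ↦ ⟨by rw [sub_self, norm_zero]; norm_num, ?_⟩
  obtain ⟨hd, hc, h0⟩ := hasDerivAt_of_isFutureCausalCurveOn hM hγ ht
  exact ⟨_, hd, hc, h0⟩

/-- **Causally convex coordinate neighbourhoods**: the sets
`U_ρ(c) = {y | ‖y − c‖ + 2 |y⁰ − c⁰| < ρ}` are causally convex in the Kerr exterior: a future causal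
curve segment with endpoints in `U_ρ(c)` stays in `U_ρ(c)` (speed bound `2` from either end).
[cite: ONeill1983, Ch. 14, p. 403] -/
theorem causallyConvex_coordNhd [Kerr.Facts] (hM : 0 ≤ M) (c : E4) (ρ : ℝ) :
    ∀ (γ : ℝ → Kerr.exterior M a) (s₁ s₂ : ℝ), s₁ ≤ s₂ →
      (Kerr.smoothMetric M a (Kerr.rPlus M a)).IsFutureCausalCurveOn
        (Kerr.exteriorSpacetime M a hM).timeOrientation γ (Icc s₁ s₂) →
      γ s₁ ∈ {y : Kerr.exterior M a | ‖(y : E4) - c‖ + 2 * |(y : E4) 0 - c 0| < ρ} →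
      γ s₂ ∈ {y : Kerr.exterior M a | ‖(y : E4) - c‖ + 2 * |(y : E4) 0 - c 0| < ρ} →
      MapsTo γ (Icc s₁ s₂) {y : Kerr.exterior M a | ‖(y : E4) - c‖ + 2 * |(y : E4) 0 - c 0| < ρ} := by
  intro γ s₁ s₂ hs hγ h₁ h₂ t ht
  simp only [mem_setOf_eq] at h₁ h₂ ⊢
  -- kinematics on `[s₁, t]` and on `[t, s₂]`
  obtain ⟨hmono₁, hdist₁⟩ := kinematics_of_isFutureCausalCurveOn hM ht.1 (hγ.mono (Icc_subset_Icc le_rfl ht.2))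
  obtain ⟨hmono₂, hdist₂⟩ := kinematics_of_isFutureCausalCurveOn hM ht.2 (hγ.mono (Icc_subset_Icc ht.1 le_rfl))
  have ht₁ : (γ s₁ : E4) 0 ≤ (γ t : E4) 0 := hmono₁.monotoneOn (left_mem_Icc.2 ht.1) (right_mem_Icc.2 ht.1) ht.1
  have ht₂ : (γ t : E4) 0 ≤ (γ s₂ : E4) 0 := hmono₂.monotoneOn (left_mem_Icc.2 ht.2) (right_mem_Icc.2 ht.2) ht.2
  rcases le_total ((γ t : E4) 0) (c 0) with hle | hle
  · -- below the level of `c`: go back to `γ s₁`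
    have hn : ‖(γ t : E4) - c‖ ≤ ‖(γ t : E4) - γ s₁‖ + ‖(γ s₁ : E4) - c‖ := norm_sub_le_norm_sub_add_norm_sub _ _ _
    have hn' : ‖(γ t : E4) - γ s₁‖ ≤ 2 * ((γ t : E4) 0 - (γ s₁ : E4) 0) := hdist₁
    have e1 : |(γ t : E4) 0 - c 0| = c 0 - (γ t : E4) 0 := by rw [abs_of_nonpos (by linarith)]; ring
    have e2 : (γ s₁ : E4) 0 - c 0 ≤ |(γ s₁ : E4) 0 - c 0| := le_abs_self _
    have e3 : c 0 - (γ s₁ : E4) 0 ≤ |(γ s₁ : E4) 0 - c 0| := by rw [abs_sub_comm]; exact le_abs_self _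
    rw [e1]; linarith
  · have hn : ‖(γ t : E4) - c‖ ≤ ‖(γ s₂ : E4) - γ t‖ + ‖(γ s₂ : E4) - c‖ := by
      rw [← norm_neg ((γ s₂ : E4) - γ t)]
      have : (γ t : E4) - c = -((γ s₂ : E4) - γ t) + ((γ s₂ : E4) - c) := by abel
      rw [this]; exact norm_add_le _ _
    have hn' : ‖(γ s₂ : E4) - γ t‖ ≤ 2 * ((γ s₂ : E4) 0 - (γ t : E4) 0) := hdist₂
    have e1 : |(γ t : E4) 0 - c 0| = (γ t : E4) 0 - c 0 := abs_of_nonneg (by linarith)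
    have e3 : (γ s₂ : E4) 0 - c 0 ≤ |(γ s₂ : E4) 0 - c 0| := le_abs_self _
    rw [e1]; linarith

/-- The coordinate neighbourhoods `U_ρ(c)` are open. [folklore] -/
theorem isOpen_coordNhd (c : E4) (ρ : ℝ) :
    IsOpen {y : Kerr.exterior M a | ‖(y : E4) - c‖ + 2 * |(y : E4) 0 - c 0| < ρ} := by
  have h : Continuous fun y : Kerr.exterior M a ↦ ‖(y : E4) - c‖ + 2 * |(y : E4) 0 - c 0| := by
    fun_prop
  exact isOpen_lt h continuous_const

/-- A point is in its own coordinate neighbourhood. [folklore] -/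
theorem mem_coordNhd_self (c : Kerr.exterior M a) {ρ : ℝ} (hρ : 0 < ρ) :
    c ∈ {y : Kerr.exterior M a | ‖(y : E4) - c‖ + 2 * |(y : E4) 0 - (c : E4) 0| < ρ} := by
  simp [hρ]

/-! ## Positivity of the length of timelike curves -/

/-- **A future timelike curve segment of the Kerr exterior has positive length**, hence chronologically
related points have positive time separation. (Measurability of the coordinate velocity `deriv`,
positivity of the speed pointwise.) [cite: ONeill1983, Ch. 14, Def. 14.15] -/
theorem lorentzDist_pos_of_mem_chronologicalFuture [Kerr.Facts] (hM : 0 ≤ M) {p q : Kerr.exterior M a}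
    (h : q ∈ (Kerr.smoothMetric M a (Kerr.rPlus M a)).chronologicalFuture
      (Kerr.exteriorSpacetime M a hM).timeOrientation {p}) :
    0 < (Kerr.smoothMetric M a (Kerr.rPlus M a)).lorentzDist
      (Kerr.exteriorSpacetime M a hM).timeOrientation p q := by
  obtain ⟨p', hp', γ, t₁, t₂, ht, hγ, hγa, hγb⟩ := h
  have hp'' : p' = p := hp'
  subst hp''
  refine lt_of_lt_of_le ?_ (LorentzianMetric.arcLength_le_lorentzDist ht hγ.isFutureCausalCurveOn hγa hγb)
  -- the coordinate curve, continuously extended outside `[t₁, t₂]`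
  set c : ℝ → E4 := fun t ↦ (γ t : E4) with hc
  set ce : ℝ → E4 := fun t ↦ c (projIcc t₁ t₂ ht.le t) with hce
  have hcd : ∀ t ∈ Icc t₁ t₂, DifferentiableAt ℝ c t := fun t ht' ↦
    (hasDerivAt_of_isFutureCausalCurveOn hM hγ.isFutureCausalCurveOn ht').1.differentiableAt
  have hcc : ContinuousOn c (Icc t₁ t₂) := fun t ht' ↦ (hcd t ht').continuousAt.continuousWithinAt
  have hce_cont : Continuous ce := by
    have : ce = (Icc t₁ t₂).restrict c ∘ projIcc t₁ t₂ ht.le := by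
      funext t; rfl
    rw [this]
    exact (continuousOn_iff_continuous_restrict.1 hcc).comp continuous_projIcc
  -- on the open interval, `ce` agrees with `c` near every point
  have hagree : ∀ t ∈ Ioo t₁ t₂, ce =ᶠ[𝓝 t] c := by
    intro t ht'
    filter_upwards [Ioo_mem_nhds ht'.1 ht'.2] with s hs
    simp only [hce, projIcc_of_mem ht.le (Ioo_subset_Icc_self hs)]
  have hderiv : ∀ t ∈ Ioo t₁ t₂, deriv ce t = deriv c t := fun t ht' ↦ (hagree t ht').deriv_eq
  -- the measurable integrand
  set F : ℝ → ℝ := fun t ↦ Real.sqrt |Kerr.bilin M a (ce t) (deriv ce t) (deriv ce t)| with hF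
  have hFm : Measurable F := by
    have h1 : Measurable (deriv ce) := measurable_deriv ce
    have hce_mem : ∀ t, ce t ∈ (Kerr.region a (Kerr.rPlus M a) : Set E4) := fun t ↦ (γ _).2
    have hb : Continuous fun t ↦ Kerr.bilin M a (ce t) :=
      ((Kerr.contDiffOn_bilin_region M a (Kerr.rPlus M a) (n := 0)).continuousOn).comp_continuous
        hce_cont hce_mem
    have h2 : Continuous fun p : (E4 →L[ℝ] E4 →L[ℝ] ℝ) × E4 ↦ p.1 p.2 p.2 := by fun_prop
    have h3 : Measurable fun t ↦ Kerr.bilin M a (ce t) (deriv ce t) (deriv ce t) :=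
      h2.measurable.comp (hb.measurable.prodMk h1)
    exact Real.continuous_sqrt.measurable.comp (continuous_abs.measurable.comp h3)
  -- the speed is `F` on the open interval
  have hspeed : ∀ t ∈ Ioo t₁ t₂,
      (Kerr.smoothMetric M a (Kerr.rPlus M a)).toPseudoRiemannianMetric.speed γ t = F t := by
    intro t ht'
    have hvel : (velocity 𝓘(ℝ, E4) γ t : E4) = deriv c t := by
      rw [← velocity_subtypeVal_comp (I := 𝓘(ℝ, E4)) (Kerr.region a (Kerr.rPlus M a)) γ t]
      change mfderiv 𝓘(ℝ, ℝ) 𝓘(ℝ, E4) (Subtype.val ∘ γ) t (1 : ℝ) = _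
      rw [mfderiv_eq_fderiv]
      rfl
    rw [PseudoRiemannianMetric.speed_def, hF]
    simp only
    rw [hderiv t ht']
    have hcet : ce t = c t := (hagree t ht').eq_of_nhds
    rw [hcet]
    show Real.sqrt |Kerr.bilin M a (c t) (velocity 𝓘(ℝ, E4) γ t) (velocity 𝓘(ℝ, E4) γ t)| = _
    rw [hvel]
  have hFpos : ∀ t ∈ Ioo t₁ t₂, 0 < F t := by
    intro t ht'
    rw [← hspeed t ht', PseudoRiemannianMetric.speed_def]
    obtain ⟨-, htl, -⟩ := hγ t (Ioo_subset_Icc_self ht')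
    have : (Kerr.smoothMetric M a (Kerr.rPlus M a)).val (γ t) (velocity 𝓘(ℝ, E4) γ t)
        (velocity 𝓘(ℝ, E4) γ t) < 0 := htl
    exact Real.sqrt_pos.2 (abs_pos.2 this.ne)
  -- compute the length over the open interval
  rw [PseudoRiemannianMetric.arcLength_eq_lintegral_Ioo]
  have hcongr : ∫⁻ t in Ioo t₁ t₂, ENNReal.ofReal
      ((Kerr.smoothMetric M a (Kerr.rPlus M a)).toPseudoRiemannianMetric.speed γ t) =
      ∫⁻ t in Ioo t₁ t₂, ENNReal.ofReal (F t) :=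
    MeasureTheory.setLIntegral_congr_fun measurableSet_Ioo fun t ht' ↦ by rw [hspeed t ht']
  rw [hcongr]
  have hm : Measurable fun t ↦ ENNReal.ofReal (F t) := ENNReal.measurable_ofReal.comp hFm
  rw [MeasureTheory.lintegral_pos_iff_support hm]
  have hsub : Ioo t₁ t₂ ⊆ Function.support fun t ↦ ENNReal.ofReal (F t) := fun t ht' ↦ by
    rw [Function.mem_support]
    exact (ENNReal.ofReal_pos.2 (hFpos t ht')).ne'
  calc (0 : ℝ≥0∞) < volume (Ioo t₁ t₂) := by rw [Real.volume_Ioo]; exact ENNReal.ofReal_pos.2 (by linarith)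
    _ = (volume.restrict (Ioo t₁ t₂)) (Ioo t₁ t₂) := by
        rw [MeasureTheory.Measure.restrict_apply_self]
    _ ≤ (volume.restrict (Ioo t₁ t₂)) (Function.support fun t ↦ ENNReal.ofReal (F t)) :=
        MeasureTheory.measure_mono hsub

/-! ## The radial representation of causally / chronologically related nearby points -/

/-- **Local radial representation in the Kerr exterior.** Every point `c` of the Kerr exterior has a
coordinate radius `ρ > 0` and a two-point inverse `Ξ` of the exponential map such that for all `p, q`
in the causally convex coordinate neighbourhood `U_ρ(c)` with `q ∈ J⁺(p)`, `q ≠ p`: the vector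
`v = exp_p⁻¹ q` (read through the trivialisation at `c`) is future causal, lies in the domain of
`exp_p`, `exp_p v = q`, and `d(p, q) = √(−g(v, v))`; in particular `v` is TIMELIKE when `q ∈ I⁺(p)`.
(`exists_nhds_lorentzDist_eq_radial` + `causallyConvex_coordNhd` +
`lorentzDist_pos_of_mem_chronologicalFuture`.) [cite: Sbierski2016AHP, §3.2, proof of Thm. 12] -/
theorem exists_radial_representation [Kerr.Facts] [Kerr.SliceFacts] (hM : 0 ≤ M)
    (c : Kerr.exterior M a) :
    ∃ (ρ : ℝ) (Ξ : Kerr.exterior M a → Kerr.exterior M a → E4), 0 < ρ ∧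
      ∀ p q : Kerr.exterior M a,
        ‖(p : E4) - c‖ + 2 * |(p : E4) 0 - (c : E4) 0| < ρ →
        ‖(q : E4) - c‖ + 2 * |(q : E4) 0 - (c : E4) 0| < ρ →
        q ∈ (Kerr.smoothMetric M a (Kerr.rPlus M a)).causalFuture
          (Kerr.exteriorSpacetime M a hM).timeOrientation {p} → q ≠ p →
        ((trivializationAt E4 (TangentSpace 𝓘(ℝ, E4) : Kerr.exterior M a → Type _) c).symmL ℝ p (Ξ p q) :
            TangentSpace 𝓘(ℝ, E4) p) ∈ expDomain (Kerr.smoothMetric M a (Kerr.rPlus M a)).leviCivita p ∧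
        expMap (Kerr.smoothMetric M a (Kerr.rPlus M a)).leviCivita p
          ((trivializationAt E4 (TangentSpace 𝓘(ℝ, E4) : Kerr.exterior M a → Type _) c).symmL ℝ p (Ξ p q)) = q ∧
        (Kerr.exteriorSpacetime M a hM).timeOrientation.IsFutureDirected (x := p)
          ((trivializationAt E4 (TangentSpace 𝓘(ℝ, E4) : Kerr.exterior M a → Type _) c).symmL ℝ p (Ξ p q)) ∧
        (q ∈ (Kerr.smoothMetric M a (Kerr.rPlus M a)).chronologicalFuture
            (Kerr.exteriorSpacetime M a hM).timeOrientation {p} →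
          (Kerr.smoothMetric M a (Kerr.rPlus M a)).IsTimelike (x := p)
            ((trivializationAt E4 (TangentSpace 𝓘(ℝ, E4) : Kerr.exterior M a → Type _) c).symmL ℝ p (Ξ p q))) := by
  haveI := LorentzianMetric.contMDiffCovariantDerivative_leviCivita_one (Kerr.smoothMetric M a (Kerr.rPlus M a))
  set τK := (Kerr.exteriorSpacetime M a hM).timeOrientation with hτK
  obtain ⟨W, Ξ, hWo, hcW, -, -, hΞ, hform⟩ :=
    LorentzianMetric.exists_nhds_lorentzDist_eq_radial (g := Kerr.smoothMetric M a (Kerr.rPlus M a)) τK le_rfl c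
  -- a coordinate radius `ρ` with `U_ρ(c) ⊆ W`
  obtain ⟨ρ, hρ, hball⟩ := Metric.isOpen_iff.1 hWo c hcW
  refine ⟨ρ, Ξ, hρ, fun p q hp hq hpq hne ↦ ?_⟩
  set U : Set (Kerr.exterior M a) :=
    {y : Kerr.exterior M a | ‖(y : E4) - c‖ + 2 * |(y : E4) 0 - (c : E4) 0| < ρ} with hU
  have hUW : U ⊆ W := by
    intro y hy
    apply hball
    rw [Metric.mem_ball]
    change dist (y : E4) (c : E4) < ρ
    rw [dist_eq_norm]
    have : ‖(y : E4) - c‖ + 2 * |(y : E4) 0 - (c : E4) 0| < ρ := hy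
    linarith [abs_nonneg ((y : E4) 0 - (c : E4) 0)]
  have hUcc := causallyConvex_coordNhd (a := a) hM (c : E4) ρ
  have hpU : p ∈ U := hp
  have hqU : q ∈ U := hq
  obtain ⟨hvf, -, hdist, -⟩ := hform U hUW
    (fun γ s₁ s₂ hs hγ h₁ h₂ ↦ hUcc γ s₁ s₂ hs hγ h₁ h₂) p hpU q hqU hpq hne
  obtain ⟨hdom, hexp⟩ := hΞ p (hUW hpU) q (hUW hqU)
  refine ⟨hdom, hexp, hvf, fun hchr ↦ ?_⟩
  have hpos := lorentzDist_pos_of_mem_chronologicalFuture hM hchr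
  rw [hdist, ENNReal.ofReal_pos, Real.sqrt_pos, neg_pos] at hpos
  exact hpos

/-- **Registered sub-goal `stub_noC0_kerrLocal`** (NoC0KerrChart programme, Kerr side, local causality):
the radial representation of causally / chronologically related nearby points of the Kerr exterior, in
`∀`-form (`exists_radial_representation`). [cite: Sbierski2016AHP, §3.2, proof of Thm. 12] -/
theorem stub_noC0_kerrLocal : ∀ (M a : ℝ) [Kerr.Facts] [Kerr.SliceFacts] (hM : 0 ≤ M) (c : Kerr.exterior M a), ∃ (ρ : ℝ) (Ξ : Kerr.exterior M a → Kerr.exterior M a → E4), 0 < ρ ∧ ∀ p q : Kerr.exterior M a, ‖(p : E4) - c‖ + 2 * |(p : E4) 0 - (c : E4) 0| < ρ → ‖(q : E4) - c‖ + 2 * |(q : E4) 0 - (c : E4) 0| < ρ → q ∈ (Kerr.smoothMetric M a (Kerr.rPlus M a)).causalFuture (Kerr.exteriorSpacetime M a hM).timeOrientation {p} → q ≠ p → ((trivializationAt E4 (TangentSpace 𝓘(ℝ, E4) : Kerr.exterior M a → Type _) c).symmL ℝ p (Ξ p q) : TangentSpace 𝓘(ℝ, E4) p) ∈ Literature.Geometry.Riemannian.expDomain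 (Kerr.smoothMetric M a (Kerr.rPlus M a)).leviCivita p ∧ Literature.Geometry.Riemannian.expMap (Kerr.smoothMetric M a (Kerr.rPlus M a)).leviCivita p ((trivializationAt E4 (TangentSpace 𝓘(ℝ, E4) : Kerr.exterior M a → Type _) c).symmL ℝ p (Ξ p q)) = q ∧ (Kerr.exteriorSpacetime M a hM).timeOrientation.IsFutureDirected (x := p) ((trivializationAt E4 (TangentSpace 𝓘(ℝ, E4) : Kerr.exterior M a → Type _) c).symmL ℝ p (Ξ p q)) ∧ (q ∈ (Kerr.smoothMetric M a (Kerr.rPlus M a)).chronologicalFuture (Kerr.exteriorSpacetime M a hM).timeOrientation {p} → (Kerr.smoothMetric M a (Kerr.rPlus M a)).IsTimelike (x := p) ((trivializationAt E4 (TangentSpace 𝓘(ℝ, E4) : Kerr.exterior M a → Type _) c).symmL ℝ p (Ξ p q))) :=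
  fun _ _ _ _ hM c ↦ exists_radial_representation hM c

end NoC0

end Summit.FinalStateConjecture.FinalStateConjecture.Theorems.PhaseMixingCaptureCaptureSufficesTame

end
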